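import Summits.Ventures.YMGap.Census.CharacterPowerExpansion
import Summits.Ventures.YMGap.Census.PotentialMoving
import HarnessLib

/-!
# Venture YMGap, track (b) — the geometry of the decimation cells of `(ℤ/bLℤ)^d` over `(ℤ/Lℤ)^d`:
# coarse coordinates, the `b × b` windows tiling the coarse plaquettes, and the potential-moved integrand

HONEST FRAMING: venture file of the cell `pub-ymgap` (QuantumFields programme), track (b); lattice bookkeeping for the
exactness half of Tomboulis's Prop. III.1 (arXiv:0707.2179 §2.1: after the moves "the end result is a lattice having
elementary 2-faces of side length `ba`, each tiled by `b²` plaquettes of side length `a`", each carrying `f^ζ`,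
`ζ = b^{d-2}`).  Nothing here concerns (5.15), limits, confinement or a mass gap.

* `scale b L : ℤ/L → ℤ/bL`, `w ↦ b·w` (additive, injective, `resb ∘ scale = 0`), the division with remainder
  `z = scale (quot z) + (z.val % b)` (`scale_quot_add_rem`) and its uniqueness (`scale_add_natCast_eq_iff`).
* `corner`, `base b P s t = b·y + s e_μ + t e_ν`, `finePlaq`, `hLink`, `vLink` — the fine plaquettes and links of the
  window of the coarse plaquette `P = (y, μ < ν)`; `plaquetteHolonomy_base`.
* `finePlaq_survives`, `finePlaq_of_survives`, `finePlaq_injective` — the plaquettes of `(ℤ/bL)^d` carrying `f^ζ` after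
  the complete move (`PotentialMoving.mkExpS_univ`: all perpendicular coordinates `≡ 0 mod b`) are exactly the
  `finePlaq b P s t`, `s, t < b`, each once (`prod_pow_mkExp_eq_prod_window`).
* **`powFieldFn_mkExp_eq`** — the potential-moved integrand is
  `F̂₀^{b²·#plaquettes(ℤ/L)^d} · ∏_P ∏_{s,t<b} Σ_m stdCoef(ĉ)_m χ_m(U_{finePlaq P s t})` with `ĉ = hatCoeff J c ζ` and cut-off
  `ζJ` (`CharacterPowerExpansion.fR_pow_eq_mkFhat_mul_fR`): the bulk factor `F₀^U(1)^{|Λ^{(1)}|} = F̂₀^{b²|Λ^{(1)}|}` of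
  (3.4)/(A.19) has come out, and what is left to integrate is a product of windows of plaquette functions `f_ĉ`.

References: E. T. Tomboulis, arXiv:0707.2179 §2.1, (2.17)–(2.22), (3.1)–(3.4) [cite: Tomboulis2007Confinement, §2.1].
-/

noncomputable section

open MeasureTheory Finset Real Function
open scoped BigOperators
open Literature.MathematicalPhysics.QuantumLattice
open Literature.MathematicalPhysics.QuantumFieldTheory
open Literature.MathematicalPhysics.QuantumFieldTheory.Tomboulis2007
open Literature.MathematicalPhysics.QuantumFieldTheory.WilsonRP
open Summit.Ventures.LatticeQCDFlow.Exactness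
open Summit.Ventures.LatticeQCDFlow.Scoring

namespace Summit.Ventures.YMGap.Census

variable {d L : ℕ}

/-! ### Coarse coordinates inside the fine torus -/

section Scale

variable (b L : ℕ)

/-- The coarse coordinate `w ∈ ℤ/L` as a fine coordinate: `scale b L w = b · w ∈ ℤ/bL`. -/
def scale (w : ZMod L) : ZMod (b * L) := ((b * w.val : ℕ) : ZMod (b * L))

/-- The coarse cell of a fine coordinate: `quot z = ⌊z/b⌋ ∈ ℤ/L`. -/
def quot (z : ZMod (b * L)) : ZMod L := ((z.val / b : ℕ) : ZMod L)

variable {b L}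
variable [NeZero b] [NeZero L]

/-- `(scale w).val = b · w.val`. -/
theorem scale_val (w : ZMod L) : (scale b L w).val = b * w.val := by
  unfold scale
  exact ZMod.val_natCast_of_lt (by
    have := ZMod.val_lt w
    calc b * w.val < b * L := Nat.mul_lt_mul_of_pos_left this (Nat.pos_of_ne_zero (NeZero.ne b))
      _ = b * L := rfl)

/-- `scale` is injective. -/
theorem scale_injective : Function.Injective (scale b L) := by
  intro w w' h
  have hv := congrArg ZMod.val h
  rw [scale_val, scale_val] at hv
  exact ZMod.val_injective L (Nat.eq_of_mul_eq_mul_left (Nat.pos_of_ne_zero (NeZero.ne b)) hv)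

/-- `scale (k mod L) = b k mod bL`. -/
theorem scale_natCast (k : ℕ) : scale b L (k : ZMod L) = ((b * k : ℕ) : ZMod (b * L)) := by
  apply ZMod.val_injective
  rw [scale_val, ZMod.val_natCast, ZMod.val_natCast, Nat.mul_mod_mul_left]

/-- `scale` is additive. -/
theorem scale_add (x y : ZMod L) : scale b L (x + y) = scale b L x + scale b L y := by
  apply ZMod.val_injective
  rw [scale_val, ZMod.val_add, ZMod.val_add, scale_val, scale_val, ← Nat.mul_add, Nat.mul_mod_mul_left]

omit [NeZero b] [NeZero L] in
/-- `scale 0 = 0`. -/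
theorem scale_zero : scale b L (0 : ZMod L) = 0 := by
  simp [scale]

/-- `scale 1 = b`. -/
theorem scale_one : scale b L (1 : ZMod L) = (b : ZMod (b * L)) := by
  have h := scale_natCast (b := b) (L := L) 1
  rwa [Nat.cast_one, mul_one] at h

omit [NeZero b] [NeZero L] in
/-- `scale w ≡ 0 (mod b)`. -/
theorem resb_scale (w : ZMod L) : resb b L (scale b L w) = 0 := by
  unfold scale
  rw [resb_natCast, Nat.cast_mul, ZMod.natCast_self, zero_mul]

omit [NeZero b] [NeZero L] in
/-- `scale w + k ≡ k (mod b)`. -/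
theorem resb_scale_add_natCast (w : ZMod L) (k : ℕ) : resb b L (scale b L w + (k : ZMod (b * L))) = k := by
  rw [resb_add, resb_scale, resb_natCast, zero_add]

omit [NeZero b] [NeZero L] in
/-- Positions inside cells: `scale w + j = scale w' + k` forces `j ≡ k (mod b)`. -/
theorem natCast_mod_eq_of_scale_add_eq {w w' : ZMod L} {j k : ℕ}
    (h : scale b L w + (j : ZMod (b * L)) = scale b L w' + (k : ZMod (b * L))) : j % b = k % b := by
  have h' := congrArg (resb b L) h
  rw [resb_scale_add_natCast, resb_scale_add_natCast] at h'
  exact (ZMod.natCast_eq_natCast_iff' j k b).1 h'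

/-- **Uniqueness of division with remainder**: `scale w + j = scale w' + k` with `j, k < b` iff `w = w'` and `j = k`. -/
theorem scale_add_natCast_eq_iff {w w' : ZMod L} {j k : ℕ} (hj : j < b) (hk : k < b) :
    scale b L w + (j : ZMod (b * L)) = scale b L w' + (k : ZMod (b * L)) ↔ w = w' ∧ j = k := by
  constructor
  · intro h
    have hjk : j = k := by
      have := natCast_mod_eq_of_scale_add_eq h
      rwa [Nat.mod_eq_of_lt hj, Nat.mod_eq_of_lt hk] at this
    subst hjk
    exact ⟨scale_injective (add_right_cancel h), rfl⟩
  · rintro ⟨rfl, rfl⟩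
    rfl

/-- `scale w = scale w' + k` with `k < b` iff `w = w'` and `k = 0`. -/
theorem scale_eq_scale_add_natCast_iff {w w' : ZMod L} {k : ℕ} (hk : k < b) :
    scale b L w = scale b L w' + (k : ZMod (b * L)) ↔ w = w' ∧ k = 0 := by
  have h := scale_add_natCast_eq_iff (b := b) (L := L) (w := w) (w' := w') (j := 0)
    (Nat.pos_of_ne_zero (NeZero.ne b)) hk
  rw [Nat.cast_zero, add_zero] at h
  rw [h]
  exact and_congr_right fun _ => eq_comm

/-- `(quot z).val = z.val / b`. -/
theorem quot_val (z : ZMod (b * L)) : (quot b L z).val = z.val / b := by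
  unfold quot
  rw [ZMod.val_natCast, Nat.mod_eq_of_lt]
  exact Nat.div_lt_of_lt_mul (ZMod.val_lt z)

/-- **Division with remainder**: `z = scale (quot z) + (z.val % b)`. -/
theorem scale_quot_add_rem (z : ZMod (b * L)) : scale b L (quot b L z) + ((z.val % b : ℕ) : ZMod (b * L)) = z := by
  unfold scale
  rw [quot_val, ← Nat.cast_add, Nat.div_add_mod, ZMod.natCast_zmod_val]

/-- `resb z = z.val mod b`. -/
theorem resb_eq_natCast_rem (z : ZMod (b * L)) : resb b L z = ((z.val % b : ℕ) : ZMod b) := by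
  conv_lhs => rw [← scale_quot_add_rem z]
  rw [resb_scale_add_natCast]

/-- A fine coordinate `≡ 0 (mod b)` is the corner of its cell. -/
theorem eq_scale_quot_of_resb_eq_zero {z : ZMod (b * L)} (h : resb b L z = 0) : z = scale b L (quot b L z) := by
  have hrem : z.val % b = 0 := by
    rw [resb_eq_natCast_rem] at h
    have := (ZMod.natCast_eq_natCast_iff' (z.val % b) 0 b).1 (by simpa using h)
    simpa [Nat.mod_mod] using this
  conv_lhs => rw [← scale_quot_add_rem z, hrem, Nat.cast_zero, add_zero]

end Scale

/-! ### Windows: the `b × b` fine plaquettes tiling a coarse plaquette -/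

section Window

variable (b : ℕ)

/-- The corner `b·y` of the cell of the coarse site `y`. -/
def corner (y : Site d L) : Site d (b * L) := fun κ => scale b L (y κ)

/-- The base point `b·y + s e_μ + t e_ν` of the `(s,t)`-th fine plaquette of the window of `P = (y, μ < ν)`. -/
def base (P : Plaquette d L) (s t : ℕ) : Site d (b * L) :=
  corner b P.1 + Pi.single P.2.1.1 (s : ZMod (b * L)) + Pi.single P.2.1.2 (t : ZMod (b * L))

/-- The `(s,t)`-th fine plaquette of the window of `P` (same orientation). -/
def finePlaq (P : Plaquette d L) (s t : ℕ) : Plaquette d (b * L) := (base b P s t, P.2)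

/-- The horizontal (`μ`-direction) fine link at position `(s,t)` of the window of `P`. -/
def hLink (P : Plaquette d L) (s t : ℕ) : Edge d (b * L) := (base b P s t, P.2.1.1)

/-- The vertical (`ν`-direction) fine link at position `(s,t)` of the window of `P`. -/
def vLink (P : Plaquette d L) (s t : ℕ) : Edge d (b * L) := (base b P s t, P.2.1.2)

variable {b}

/-- The two directions of a plaquette are distinct. -/
theorem dir_ne (P : Plaquette d L) : P.2.1.1 ≠ P.2.1.2 := ne_of_lt P.2.2

/-- The `μ`-coordinate of `base P s t` is `b y_μ + s`. -/
theorem base_apply_fst (P : Plaquette d L) (s t : ℕ) :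
    base b P s t P.2.1.1 = scale b L (P.1 P.2.1.1) + (s : ZMod (b * L)) := by
  simp [base, corner, Pi.single_eq_of_ne (dir_ne P)]

/-- The `ν`-coordinate of `base P s t` is `b y_ν + t`. -/
theorem base_apply_snd (P : Plaquette d L) (s t : ℕ) :
    base b P s t P.2.1.2 = scale b L (P.1 P.2.1.2) + (t : ZMod (b * L)) := by
  simp [base, corner, Pi.single_eq_of_ne (dir_ne P).symm]

/-- A perpendicular coordinate of `base P s t` is `b y_κ`. -/
theorem base_apply_perp (P : Plaquette d L) (s t : ℕ) {κ : Fin d} (h1 : κ ≠ P.2.1.1) (h2 : κ ≠ P.2.1.2) :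
    base b P s t κ = scale b L (P.1 κ) := by
  simp [base, corner, Pi.single_eq_of_ne h1, Pi.single_eq_of_ne h2]

/-- Moving one step in `μ`. -/
theorem base_shift_fst (P : Plaquette d L) (s t : ℕ) : (base b P s t).shift P.2.1.1 = base b P (s + 1) t := by
  unfold Site.shift base
  rw [Nat.cast_succ, Pi.single_add]
  abel

/-- Moving one step in `ν`. -/
theorem base_shift_snd (P : Plaquette d L) (s t : ℕ) : (base b P s t).shift P.2.1.2 = base b P s (t + 1) := by
  unfold Site.shift base
  rw [Nat.cast_succ, Pi.single_add]
  abel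

/-- **The holonomy of a fine plaquette of the window** in terms of the window links:
`U_{(s,t)} = U(h_{s,t}) U(v_{s+1,t}) U(h_{s,t+1})⁻¹ U(v_{s,t})⁻¹`. -/
theorem plaquetteHolonomy_base {G : Type*} [Group G] (U : GaugeConfig d (b * L) G) (P : Plaquette d L) (s t : ℕ) :
    plaquetteHolonomy U (base b P s t) P.2.1.1 P.2.1.2 =
      U (hLink b P s t) * U (vLink b P (s + 1) t) * (U (hLink b P s (t + 1)))⁻¹ * (U (vLink b P s t))⁻¹ := by
  simp only [plaquetteHolonomy, base_shift_fst, base_shift_snd, hLink, vLink]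

/-! ### The surviving plaquettes are exactly the window plaquettes -/

variable [NeZero b] [NeZero L]

omit [NeZero b] [NeZero L] in
/-- The orientation of a window plaquette is that of its coarse plaquette. -/
theorem perpDirs_finePlaq (P : Plaquette d L) (s t : ℕ) : perpDirs (finePlaq b P s t) = perpDirs ((0 : Site d L), P.2) :=
  rfl

omit [NeZero b] [NeZero L] in
/-- Window plaquettes survive the complete move: all their perpendicular coordinates are `≡ 0 (mod b)`. -/
theorem finePlaq_survives (P : Plaquette d L) (s t : ℕ) :
    ∀ κ ∈ perpDirs (finePlaq b P s t), resb b L ((finePlaq b P s t).1 κ) = 0 := by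
  intro κ hκ
  rw [mem_perpDirs] at hκ
  show resb b L (base b P s t κ) = 0
  rw [base_apply_perp P s t hκ.1 hκ.2, resb_scale]

/-- The coarse plaquette under a fine plaquette. -/
def coarseOf (b : ℕ) (q : Plaquette d (b * L)) : Plaquette d L := (fun κ => quot b L (q.1 κ), q.2)

/-- **A surviving plaquette is a window plaquette**: `q = finePlaq (coarseOf q) (q_μ mod b) (q_ν mod b)`. -/
theorem finePlaq_of_survives {q : Plaquette d (b * L)} (hq : ∀ κ ∈ perpDirs q, resb b L (q.1 κ) = 0) :
    finePlaq b (coarseOf b q) ((q.1 q.2.1.1).val % b) ((q.1 q.2.1.2).val % b) = q := by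
  refine Prod.ext ?_ rfl
  funext κ
  show base b (coarseOf b q) ((q.1 q.2.1.1).val % b) ((q.1 q.2.1.2).val % b) κ = q.1 κ
  by_cases h1 : κ = q.2.1.1
  · subst h1
    exact (base_apply_fst (coarseOf b q) _ _).trans (scale_quot_add_rem (q.1 q.2.1.1))
  · by_cases h2 : κ = q.2.1.2
    · subst h2
      exact (base_apply_snd (coarseOf b q) _ _).trans (scale_quot_add_rem (q.1 q.2.1.2))
    · rw [base_apply_perp (coarseOf b q) _ _ h1 h2]
      exact (eq_scale_quot_of_resb_eq_zero (hq κ (mem_perpDirs.2 ⟨h1, h2⟩))).symm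

/-- **Window plaquettes are pairwise distinct** (`s, t, s', t' < b`). -/
theorem finePlaq_injective {P P' : Plaquette d L} {s t s' t' : ℕ} (hs : s < b) (ht : t < b) (hs' : s' < b)
    (ht' : t' < b) (h : finePlaq b P s t = finePlaq b P' s' t') : P = P' ∧ s = s' ∧ t = t' := by
  simp only [finePlaq, Prod.mk.injEq] at h
  obtain ⟨h1, h2⟩ := h
  have hμ : scale b L (P.1 P.2.1.1) + (s : ZMod (b * L)) = scale b L (P'.1 P.2.1.1) + (s' : ZMod (b * L)) := by
    have := congrFun h1 P.2.1.1
    rw [base_apply_fst] at this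
    rw [this, h2, base_apply_fst]
  have hν : scale b L (P.1 P.2.1.2) + (t : ZMod (b * L)) = scale b L (P'.1 P.2.1.2) + (t' : ZMod (b * L)) := by
    have := congrFun h1 P.2.1.2
    rw [base_apply_snd] at this
    rw [this, h2, base_apply_snd]
  obtain ⟨hyμ, hss⟩ := (scale_add_natCast_eq_iff hs hs').1 hμ
  obtain ⟨hyν, htt⟩ := (scale_add_natCast_eq_iff ht ht').1 hν
  refine ⟨Prod.ext (funext fun κ => ?_) h2, hss, htt⟩
  by_cases hκ1 : κ = P.2.1.1
  · rw [hκ1]; exact hyμ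
  by_cases hκ2 : κ = P.2.1.2
  · rw [hκ2]; exact hyν
  have := congrFun h1 κ
  rw [base_apply_perp P s t hκ1 hκ2, base_apply_perp P' s' t' (h2 ▸ hκ1) (h2 ▸ hκ2)] at this
  exact scale_injective this

/-- The window parametrisation `(P, s, t) ↦ finePlaq P s t` on `Plaquette d L × Fin b × Fin b`. -/
def windowMap (b : ℕ) (x : Plaquette d L × (Fin b × Fin b)) : Plaquette d (b * L) := finePlaq b x.1 x.2.1 x.2.2

/-- `windowMap` is injective. -/
theorem windowMap_injective : Function.Injective (windowMap (d := d) (L := L) b) := by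
  rintro ⟨P, s, t⟩ ⟨P', s', t'⟩ h
  obtain ⟨hP, hs, ht⟩ := finePlaq_injective s.2 t.2 s'.2 t'.2 h
  subst hP
  simp only [Prod.mk.injEq, true_and]
  exact ⟨Fin.ext hs, Fin.ext ht⟩

/-- **The surviving plaquettes are exactly the image of the window parametrisation.** -/
theorem filter_survives_eq_image :
    (univ : Finset (Plaquette d (b * L))).filter (fun q => ∀ κ ∈ perpDirs q, resb b L (q.1 κ) = 0) =
      (univ : Finset (Plaquette d L × (Fin b × Fin b))).image (windowMap b) := by
  ext q
  simp only [Finset.mem_filter, Finset.mem_univ, true_and, Finset.mem_image]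
  constructor
  · intro hq
    have hb : 0 < b := Nat.pos_of_ne_zero (NeZero.ne b)
    exact ⟨(coarseOf b q, (⟨(q.1 q.2.1.1).val % b, Nat.mod_lt _ hb⟩, ⟨(q.1 q.2.1.2).val % b, Nat.mod_lt _ hb⟩)),
      finePlaq_of_survives hq⟩
  · rintro ⟨x, rfl⟩
    exact finePlaq_survives x.1 x.2.1 x.2.2

/-- **Re-indexing the potential-moved product by windows**: the completely moved exponent field puts `g(q)^ζ` on the
window plaquettes and `1` elsewhere. -/
theorem prod_pow_mkExp_eq_prod_window (g : Plaquette d (b * L) → ℝ) (ζ : ℕ) :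
    ∏ q : Plaquette d (b * L), g q ^ (if ∀ κ ∈ perpDirs q, resb b L (q.1 κ) = 0 then ζ else 0) =
      ∏ x : Plaquette d L × (Fin b × Fin b), g (windowMap b x) ^ ζ := by
  have h1 : ∀ q : Plaquette d (b * L), g q ^ (if ∀ κ ∈ perpDirs q, resb b L (q.1 κ) = 0 then ζ else 0) =
      if ∀ κ ∈ perpDirs q, resb b L (q.1 κ) = 0 then g q ^ ζ else 1 := fun q => by
    split_ifs <;> simp
  simp_rw [h1]
  rw [← Finset.prod_filter, filter_survives_eq_image,
    Finset.prod_image fun x _ y _ h => windowMap_injective h]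

/-! ### The potential-moved integrand as a product of windows -/

omit [NeZero b] in
/-- There are `b² · #plaquettes(ℤ/L)^d` window plaquettes. -/
theorem card_window : Fintype.card (Plaquette d L × (Fin b × Fin b)) = Fintype.card (Plaquette d L) * b ^ 2 := by
  simp only [Fintype.card_prod, Fintype.card_fin]
  ring

/-- **The potential-moved integrand is a product of windows of the decimated plaquette function**:
`∏_q f_c(U_q)^{e_MK(q)} = F̂₀^{b²·#Plaq} · ∏_{(P,s,t)} Σ_m stdCoef(ĉ)_m χ_m(U_{finePlaq P s t})`, `ĉ = hatCoeff J c ζ`,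
cut-off `ζJ` (arXiv:0707.2179 (RG1)–(RG5): `f^ζ = F̂₀ f_ĉ` on every tiling plaquette). -/
theorem powFieldFn_mkExp_eq (J : ℕ) {c : ℕ → ℝ} (hc : ∀ n, 1 ≤ n → 0 ≤ c n) (ζ : ℕ) (W : GaugeConfig d (b * L) SU2) :
    powFieldFn J c (fun q : Plaquette d (b * L) => if ∀ κ ∈ perpDirs q, resb b L (q.1 κ) = 0 then ζ else 0) W =
      mkFhat J c ζ 0 ^ (Fintype.card (Plaquette d L) * b ^ 2) *
        ∏ x : Plaquette d L × (Fin b × Fin b), faceSum (ζ * J) (stdCoef (hatCoeff J c ζ))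
          (plaquetteHolonomy W (base b x.1 x.2.1 x.2.2) x.1.2.1.1 x.1.2.1.2) := by
  unfold powFieldFn
  rw [prod_pow_mkExp_eq_prod_window (fun q => fR J c (plaqRe rhoFund W q)) ζ]
  simp_rw [fR_pow_eq_mkFhat_mul_fR hc ζ]
  rw [Finset.prod_mul_distrib, Finset.prod_const, Finset.card_univ, card_window]
  congr 1
  refine Finset.prod_congr rfl fun x _ => ?_
  exact fR_eq_faceSum (ζ * J) (hatCoeff J c ζ) W (windowMap b x)

/-- The integrand of the window integral. -/
def windowFn (b : ℕ) (K : ℕ) (A : ℕ → ℝ) (W : GaugeConfig d (b * L) SU2) : ℝ :=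
  ∏ x : Plaquette d L × (Fin b × Fin b), faceSum K A (plaquetteHolonomy W (base b x.1 x.2.1 x.2.2) x.1.2.1.1 x.1.2.1.2)

/-- **The potential-moved partition function is `F̂₀^{b²·#Plaq}` times the window integral.** -/
theorem powFieldZ_mkExp_eq (J : ℕ) {c : ℕ → ℝ} (hc : ∀ n, 1 ≤ n → 0 ≤ c n) (ζ : ℕ) :
    powFieldZ J c (fun q : Plaquette d (b * L) => if ∀ κ ∈ perpDirs q, resb b L (q.1 κ) = 0 then ζ else 0) =
      mkFhat J c ζ 0 ^ (Fintype.card (Plaquette d L) * b ^ 2) *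
        ∫ W, windowFn (L := L) b (ζ * J) (stdCoef (hatCoeff J c ζ)) W
          ∂(Measure.pi fun _ : Edge d (b * L) => haarProbability SU2) := by
  unfold powFieldZ windowFn
  simp_rw [powFieldFn_mkExp_eq J hc ζ]
  exact integral_const_mul _ _

end Window

end Summit.Ventures.YMGap.Census

end
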